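import Summits.QuantumFields.YangMills.Theorems.BalabanLadderIRReflectedAntipodalCofinalLeaf
import HarnessLib

/-!
# Crux `BalabanLadder.IRcof` (stmt-QuantumFields-26930): the simply-connected conjunct re-faced, and the reflected leaf's bookkeeping
# (helper for stmt-QuantumFields-26930; LEAD prover ym-ir-line-ab-p1 gen 6; companion of idea-14's `…ReflectedAntipodalCofinal{,Leaf}`)

HONEST STATUS.  Reflection-positivity bookkeeping only (equivalences and monotonicities); nothing here proves `BalabanLadder.IRcof`
(26930), `BalabanLadder.IR` (19354), `IRscCof`, `IRnscCof`, any lattice mass gap, or the Clay Yang–Mills problem (R4 = the conditional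
finite-𝕋⁴ rung `BalabanLadder.UV` only).

Idea-14's landed files prove `GapOn G r a Bset ↔ ReflectedAntipodalDecayOn G r a Bset` (`…Cofinal`), `IRnscCof ↔ IRnscCofRefl`
(`…Cofinal`) and `IRcof ↔ IRcofRefl` (`…CofinalLeaf`).  This file completes the picture on the side the 26930 slot of record
(`Cruxes/IRcof/Lines/pinned_cofinal_bill.lean`: `IRcof ⇐ PXcof(1/24) ∧ N_cof`) pays for with THE NUMBER:
* `IRscCofRefl`, `IRscCof_iff_reflected : RankPurity.IRscCof ↔ IRscCofRefl` — the simply-connected conjunct (reached from PXcof by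
  `PinnedExitCofinal.cofinalGapOn_of_pinnedExits`) IS cofinal reflected antipodal mirror decay of single species;
* `IRcofRefl_iff_split : IRcofRefl ↔ IRscCofRefl ∧ IRnscCofRefl` — the reflected leaf splits by `π₁` exactly as `RankPurity.ircof_iff_split`;
* `reflectedAntipodalDecayOn_univ_iff`, `gapOn_univ_iff'`, `reflectedAntipodalDecayOn_mono`, `gapOn_mono` — `Bset = univ` is the uniform
  currency (`ReflectedAntipodalDecay`, `GapInUnits`), and both families are monotone in the coupling set;
* `IRcofRefl_of_IRrefl`, `IRnscCofRefl_of_IRnscRefl`, `IRcofRefl_of_IR` — uniform ⇒ cofinal in the reflected currency (the declared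
  supplier edge `IR ⇒ IRcof` of the route, re-faced).
All definitions and estimates are REUSED BY NAME (`GapOn`, `ReflectedAntipodalDecayOn`, `gapOn_of_reflectedAntipodalOn`, `IRcofRefl`, …).
References: K. Osterwalder, E. Seiler, Ann. Phys. 110 (1978) 440 §2 (mechanism, folklore); tree `SoloBlind*` (rung D8) and
`BalabanLadderIRReflectedAntipodal{,Cofinal,CofinalLeaf}` (ym-ir-idea-14 gen 4).
-/

open MeasureTheory Filter Topology
open Literature.MathematicalPhysics.QuantumFieldTheory Literature.MathematicalPhysics.QuantumLattice
open Summit.QuantumFields.YangMills.Cruxes.OSLegsFromFemtoAndGap.DlrCollarTransfer (GapInUnits LowerBounds)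
open Summit.QuantumFields.YangMills.Cruxes.IR.RankPurity (IRscCof IRnscCof)

noncomputable section

namespace Summit.QuantumFields.YangMills.Cruxes.IR.ReflectedAntipodal

variable {G : Type} [Group G] [TopologicalSpace G] [IsTopologicalGroup G] [CompactSpace G]
  [MeasurableSpace G] [BorelSpace G]

/-! ## §1 Bookkeeping on the coupling set -/

section Units
variable (G) (r : LatticeRep G) (a : ℝ → ℝ)

/-- `Bset = univ`: `ReflectedAntipodalDecayOn … univ` is part R's `ReflectedAntipodalDecay`. -/
theorem reflectedAntipodalDecayOn_univ_iff :
    ReflectedAntipodalDecayOn G r a Set.univ ↔ ReflectedAntipodalDecay G r a := by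
  unfold ReflectedAntipodalDecayOn ReflectedAntipodalDecay
  simp only [Set.mem_univ, forall_const]

/-- `Bset = univ`: `GapOn … univ` is the crux's `GapInUnits`. -/
theorem gapOn_univ_iff' : GapOn G r a Set.univ ↔ GapInUnits G r a := by
  unfold GapOn GapInUnits
  simp only [Set.mem_univ, forall_const]

/-- Reflected antipodal decay is monotone in the coupling set. -/
theorem reflectedAntipodalDecayOn_mono {B₁ B₂ : Set ℝ} (hB : B₁ ⊆ B₂) (h : ReflectedAntipodalDecayOn G r a B₂) :
    ReflectedAntipodalDecayOn G r a B₁ := by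
  obtain ⟨c₁, β₂, S₁, hc₁, hA⟩ := h
  refine ⟨c₁, β₂, S₁, hc₁, fun A => ?_⟩
  obtain ⟨C, hC⟩ := hA A
  exact ⟨C, fun β hβ hβ2 S hS => hC β (hB hβ) hβ2 S hS⟩

/-- The clustering family is monotone in the coupling set. -/
theorem gapOn_mono {B₁ B₂ : Set ℝ} (hB : B₁ ⊆ B₂) (h : GapOn G r a B₂) : GapOn G r a B₁ := by
  obtain ⟨c₁, β₂, S₁, hc₁, hAB⟩ := h
  refine ⟨c₁, β₂, S₁, hc₁, fun A B => ?_⟩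
  obtain ⟨C, hC⟩ := hAB A B
  exact ⟨C, fun β hβ hβ2 S n hS hn => hC β (hB hβ) hβ2 S n hS hn⟩

end Units

/-! ## §2 The simply-connected conjunct, re-typed; the reflected leaf splits by `π₁` -/

/-- **`IRscCofRefl` — the simply-connected conjunct `RankPurity.IRscCof` with its conclusion restricted to the reflected mirror pairs at
the antipode** (compact simple `G`, `π₁(G) = 1`; floors ⇒ a cofinal coupling set carrying reflected antipodal mirror decay). -/
def IRscCofRefl : Prop :=
  ∀ (G : Type) [Group G] [TopologicalSpace G] [IsTopologicalGroup G] [CompactSpace G],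
    IsCompactSimpleLieGroup G → SimplyConnectedSpace G →
    letI : MeasurableSpace G := borel G
    haveI : BorelSpace G := ⟨rfl⟩
    ∀ (r : LatticeRep G) (a : ℝ → ℝ), (∀ β, 0 < a β) → Tendsto a atTop (𝓝 0) → LowerBounds G r a →
      ∃ Bset : Set ℝ, (∀ x : ℝ, ∃ β ∈ Bset, x ≤ β) ∧ ReflectedAntipodalDecayOn G r a Bset

/-- **The simply-connected conjunct `IRscCof` IS cofinal reflected antipodal mirror decay for `π₁(G) = 1`** (PROVED equivalence; the
reduction is idea-14's `gapOn_of_reflectedAntipodalOn`; RP bookkeeping, no decay produced). -/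
theorem IRscCof_iff_reflected : IRscCof ↔ IRscCofRefl := by
  constructor
  · intro h G _ _ _ _ hG hsc
    letI : MeasurableSpace G := borel G
    haveI : BorelSpace G := ⟨rfl⟩
    intro r a ha ha0 hlb
    obtain ⟨Bset, hcof, hgap⟩ := h G hG hsc r a ha ha0 hlb
    exact ⟨Bset, hcof, reflectedAntipodalOn_of_gapOn hgap⟩
  · intro h G _ _ _ _ hG hsc
    letI : MeasurableSpace G := borel G
    haveI : BorelSpace G := ⟨rfl⟩
    intro r a ha ha0 hlb
    obtain ⟨Bset, hcof, hre⟩ := h G hG hsc r a ha ha0 hlb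
    exact ⟨Bset, hcof, gapOn_of_reflectedAntipodalOn ha ha0 hre⟩

/-- **The reflected leaf splits by `π₁`**: `IRcofRefl ↔ IRscCofRefl ∧ IRnscCofRefl` (as `RankPurity.ircof_iff_split` in the clustering currency). -/
theorem IRcofRefl_iff_split : IRcofRefl ↔ IRscCofRefl ∧ IRnscCofRefl := by
  constructor
  · intro h
    refine ⟨?_, ?_⟩
    · intro G _ _ _ _ hG _
      letI : MeasurableSpace G := borel G
      haveI : BorelSpace G := ⟨rfl⟩
      intro r a ha ha0 hlb
      exact h G hG r a ha ha0 hlb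
    · intro G _ _ _ _ hG _
      letI : MeasurableSpace G := borel G
      haveI : BorelSpace G := ⟨rfl⟩
      intro r a ha ha0 hlb
      exact h G hG r a ha ha0 hlb
  · rintro ⟨hsc, hnsc⟩ G _ _ _ _ hG
    letI : MeasurableSpace G := borel G
    haveI : BorelSpace G := ⟨rfl⟩
    intro r a ha ha0 hlb
    by_cases hπ : SimplyConnectedSpace G
    · exact hsc G hG hπ r a ha ha0 hlb
    · exact hnsc G hG hπ r a ha ha0 hlb

/-! ## §3 Uniform ⇒ cofinal in the reflected currency -/

/-- **`IRrefl → IRcofRefl`** (take `Bset = univ`), matching `IRcof_of_IR` for the clustering currency. -/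
theorem IRcofRefl_of_IRrefl (h : IRrefl) : IRcofRefl := by
  intro G _ _ _ _ hG
  letI : MeasurableSpace G := borel G
  haveI : BorelSpace G := ⟨rfl⟩
  intro r a ha ha0 hlb
  refine ⟨Set.univ, fun x => ⟨x, Set.mem_univ _, le_rfl⟩, ?_⟩
  exact (reflectedAntipodalDecayOn_univ_iff G r a).2 (h G hG r a ha ha0 hlb)

/-- **`IRnscRefl → IRnscCofRefl`** (N ⇒ N_cof in the reflected currency). -/
theorem IRnscCofRefl_of_IRnscRefl (h : IRnscRefl) : IRnscCofRefl := by
  intro G _ _ _ _ hG hns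
  letI : MeasurableSpace G := borel G
  haveI : BorelSpace G := ⟨rfl⟩
  intro r a ha ha0 hlb
  refine ⟨Set.univ, fun x => ⟨x, Set.mem_univ _, le_rfl⟩, ?_⟩
  exact (reflectedAntipodalDecayOn_univ_iff G r a).2 (h G hG hns r a ha ha0 hlb)

/-- **The crux `BalabanLadder.IR` (19354) implies the reflected cofinal leaf** (`IR ⇒ IRrefl ⇒ IRcofRefl`: the route's declared-supplier
edge in the reflected currency). -/
theorem IRcofRefl_of_IR (h : Summit.QuantumFields.YangMills.Theses.BalabanLadder.IR) : IRcofRefl :=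
  IRcofRefl_of_IRrefl (IR_iff_reflected.1 h)

end Summit.QuantumFields.YangMills.Cruxes.IR.ReflectedAntipodal

end
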